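import Mathlib
import Summits.ValiantsHypothesis.ValiantsHypothesis.Theorems.NewtonUnitEquationsDissociatedUniformTotalsLaw
import Summits.ValiantsHypothesis.ValiantsHypothesis.Theorems.NewtonUnitEquationsDissociatedUniformTotalsLawUnimodal
import Summits.ValiantsHypothesis.ValiantsHypothesis.Theorems.NewtonUnitEquationsDissociatedUniformTotalsLawUnimodalGraphs
import Summits.ValiantsHypothesis.ValiantsHypothesis.Theorems.NewtonUnitEquationsDissociatedUniformTotalsLawHexagon
import Summits.ValiantsHypothesis.ValiantsHypothesis.Theorems.NewtonUnitEquationsDissociatedUniformTotalsLawHexagonCount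
import Summits.ValiantsHypothesis.ValiantsHypothesis.Theorems.NewtonUnitEquationsDissociatedUniformTotalsLawHodograph
import Summits.ValiantsHypothesis.ValiantsHypothesis.Theorems.NewtonUnitEquationsDissociatedUniformTotalsLawHodographFamilies
import Summits.ValiantsHypothesis.ValiantsHypothesis.Theorems.NewtonUnitEquationsDissociatedUniformTotalsLawHodographRelabel
import Summits.ValiantsHypothesis.ValiantsHypothesis.Theorems.NewtonUnitEquationsDissociatedUniformTotalsLawMultipliers
import HarnessLib

/-!
# Crux `NewtonUnitEquations.DissociatedUniform` (stmt-ValiantsHypothesis-5905), `n = 3` totals law of model (Q**):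
# the census families WITH MULTIPLIERS by name — `T ≤ (4 + 2·min(m, q−m))·q² + 6Z` for two parabolas and a parabola read with multiplier `m`

`…TotalsLawMultipliers.totalVert_le_of_fewCrossings`-route instance for the kit-census families of NOTES-d1g3 §3 ("parabola pairs ×
polynomial `c₃ = (u z, v z²)` with multipliers"): the `m`-step CHORD CURVE of the census parabola `C(k) = (P k, Q k²)` (natural labels on
`ℤ/q`) consists of two monotone runs on two vertical lines — `(P m, Q m (2k+m))` for `k < q − m` (up) and `(P(m−q), Q(m−q)(2k+m−q))` for
`k ≥ q − m` (down) — hence is CONVEXLY ORDERED (`convexlyOrdered_chordVec_parabola`, via a two-run peak/valley lemma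
`exists_peak_of_two_runs` and g5's `cycUnimodalAt_zero_of_peak` / `cycUnimodal_of_valley`).  Consequently
(`totalVert_parabolas_multiplier_le`): for `a = (P₁k, Q₁k²)`, `b = (P₂k, Q₂k²)` and `c = k ↦ (P₃(uk), Q₃(uk)²)` (`u` a unit read as the
multiplier `m = u.val`), `T(a,b,c) ≤ (2 + 2 + 2·min(m, q − m))·q² + 6Z` — the law for these census families with a constant LINEAR in the
multiplier (census: `T/q² ≤ 2.00` throughout, kit j298398).  `TotalsLawThree C` (arbitrary labellings) remains OPEN; VP ≠ VNP is not
touched.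
[folklore: points on two parallel lines, traversed up one line and down the other, are met in convex-position order]
-/

set_option linter.dupNamespace false -- `ValiantsHypothesis.ValiantsHypothesis` (summit = problem) in every name

open scoped BigOperators Pointwise

namespace Summit.ValiantsHypothesis.ValiantsHypothesis.Theorems.NewtonUnitEquationsDissociatedUniform

namespace TotalsLaw

open Matrix

section MultiplierParabola

variable {q : ℕ} [NeZero q]

omit [NeZero q] in
/-- **Two monotone runs make a peak.**  If `g` weakly increases along `0 … J` and weakly decreases along `J+1 … q−1` (`J < q`), then for
some `p < q` it weakly increases up to `p` and weakly decreases from `p` (take `p = J` or `J + 1` according to the junction step). [folklore] -/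
theorem exists_peak_of_two_runs (g : ℕ → ℝ) {J : ℕ} (hJ : J < q) (h1 : ∀ k, k + 1 ≤ J → g k ≤ g (k + 1))
    (h2 : ∀ k, J + 1 ≤ k → k + 1 < q → g (k + 1) ≤ g k) :
    ∃ p, p < q ∧ (∀ k, k < p → g k ≤ g (k + 1)) ∧ (∀ k, p ≤ k → k + 1 < q → g (k + 1) ≤ g k) := by
  by_cases hup : J + 1 < q ∧ g J ≤ g (J + 1)
  · refine ⟨J + 1, hup.1, fun k hk => ?_, fun k hk hk1 => h2 k hk hk1⟩
    rcases Nat.lt_or_ge (k + 1) (J + 1) with hlt | hge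
    · exact h1 k (by omega)
    · rw [show k = J by omega]; exact hup.2
  · refine ⟨J, hJ, fun k hk => h1 k (by omega), fun k hk hk1 => ?_⟩
    rcases Nat.lt_or_ge J k with hlt | hge
    · exact h2 k (by omega) hk1
    · have hkJ : k = J := le_antisymm hge hk
      subst hkJ
      push Not at hup
      exact (hup hk1).le

omit [NeZero q] in
/-- **Two monotone runs make a valley** (down along `0 … J`, up along `J+1 … q−1`). [folklore] -/
theorem exists_valley_of_two_runs (g : ℕ → ℝ) {J : ℕ} (hJ : J < q) (h1 : ∀ k, k + 1 ≤ J → g (k + 1) ≤ g k)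
    (h2 : ∀ k, J + 1 ≤ k → k + 1 < q → g k ≤ g (k + 1)) :
    ∃ p, p < q ∧ (∀ k, k < p → g (k + 1) ≤ g k) ∧ (∀ k, p ≤ k → k + 1 < q → g k ≤ g (k + 1)) := by
  by_cases hdown : J + 1 < q ∧ g (J + 1) ≤ g J
  · refine ⟨J + 1, hdown.1, fun k hk => ?_, fun k hk hk1 => h2 k hk hk1⟩
    rcases Nat.lt_or_ge (k + 1) (J + 1) with hlt | hge
    · exact h1 k (by omega)
    · rw [show k = J by omega]; exact hdown.2
  · refine ⟨J, hJ, fun k hk => h1 k (by omega), fun k hk hk1 => ?_⟩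
    rcases Nat.lt_or_ge J k with hlt | hge
    · exact h2 k (by omega) hk1
    · have hkJ : k = J := le_antisymm hge hk
      subst hkJ
      push Not at hdown
      exact (hdown hk1).le

/-- The chord vectors of the census parabola, as an explicit two-run sequence. [folklore] -/
noncomputable def parabolaChord (q : ℕ) (P Q : ℝ) (m k : ℕ) : Fin 2 → ℝ :=
  if k + m < q then ![P * m, Q * m * (2 * k + m)] else ![P * ((m : ℝ) - q), Q * ((m : ℝ) - q) * (2 * k + m - q)]

omit [NeZero q] in
/-- `chordVec` of the census parabola `(P k.val, Q k.val²)` at step `m < q` is `parabolaChord`. [folklore] -/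
theorem chordVec_parabola_apply (P Q : ℝ) {m k : ℕ} (hm : m < q) (hk : k < q) :
    chordVec (fun z : ZMod q => ![P * (z.val : ℝ), Q * (z.val : ℝ) ^ 2]) (m : ZMod q) (k : ZMod q) = parabolaChord q P Q m k := by
  unfold chordVec parabolaChord
  have hkv : ((k : ZMod q)).val = k := ZMod.val_cast_of_lt hk
  have hkm : ((k : ZMod q) + (m : ZMod q)).val = (k + m) % q := by
    rw [show (k : ZMod q) + (m : ZMod q) = ((k + m : ℕ) : ZMod q) by push_cast; ring, ZMod.val_natCast]
  simp only [hkv, hkm]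
  rcases Nat.lt_or_ge (k + m) q with hlt | hge
  · rw [Nat.mod_eq_of_lt hlt, if_pos hlt]
    ext i
    fin_cases i <;>
      (simp only [Fin.zero_eta, Fin.isValue, Fin.mk_one, Pi.sub_apply, Matrix.cons_val_zero, Matrix.cons_val_one,
        Nat.cast_add]; ring)
  · have hmod : (k + m) % q = k + m - q := by
      rw [Nat.mod_eq_sub_mod (by omega), Nat.mod_eq_of_lt (by omega)]
    rw [hmod, if_neg (not_lt.2 hge)]
    have hcast : ((k + m - q : ℕ) : ℝ) = (k : ℝ) + m - q := by
      rw [Nat.cast_sub (by omega)]; push_cast; ring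
    ext i
    fin_cases i <;>
      (simp only [Fin.zero_eta, Fin.isValue, Fin.mk_one, Pi.sub_apply, Matrix.cons_val_zero, Matrix.cons_val_one,
        hcast]; ring)

omit [NeZero q] in
/-- **The chord curve of a census parabola is convexly ordered** (every step `m < q`). [folklore] -/
theorem convexlyOrdered_chordVec_parabola (P Q : ℝ) {m : ℕ} (hm : m < q) :
    ConvexlyOrdered (chordVec (fun z : ZMod q => ![P * (z.val : ℝ), Q * (z.val : ℝ) ^ 2]) (m : ZMod q)) := by
  intro w
  set g : ℕ → ℝ := fun k => w ⬝ᵥ parabolaChord q P Q m k with hg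
  have hfg : ∀ k, k < q →
      (fun z : ZMod q => w ⬝ᵥ chordVec (fun z : ZMod q => ![P * (z.val : ℝ), Q * (z.val : ℝ) ^ 2]) (m : ZMod q) z) (k : ZMod q) =
        g k := by
    intro k hk
    simp only [hg]
    rw [chordVec_parabola_apply P Q hm hk]
  -- the two runs: slope `2 w₁ Q m` on `k + m < q`, slope `2 w₁ Q (m - q)` beyond
  have run1 : ∀ k, k + 1 + m < q → g (k + 1) - g k = 2 * (w 1 * Q) * m := by
    intro k hk
    simp only [hg, parabolaChord, if_pos hk, if_pos (show k + m < q by omega), dotProduct_fin_two, Matrix.cons_val_zero,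
      Matrix.cons_val_one]
    push_cast; ring
  have run2 : ∀ k, q ≤ k + m → g (k + 1) - g k = 2 * (w 1 * Q) * ((m : ℝ) - q) := by
    intro k hk
    simp only [hg, parabolaChord, if_neg (show ¬ (k + 1 + m < q) by omega), if_neg (show ¬ (k + m < q) by omega),
      dotProduct_fin_two, Matrix.cons_val_zero, Matrix.cons_val_one]
    push_cast; ring
  have hmq : ((m : ℝ) - q) ≤ 0 := by
    have : (m : ℝ) ≤ q := by exact_mod_cast hm.le
    linarith
  have hm0 : (0 : ℝ) ≤ m := Nat.cast_nonneg m
  -- junction index `J = q - m - 1`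
  have hJ : q - m - 1 < q := by omega
  rcases le_total 0 (w 1 * Q) with hσ | hσ
  · -- peak: up on run 1, down on run 2
    obtain ⟨p, hp, hasc, hdesc⟩ := exists_peak_of_two_runs (q := q) g hJ
      (fun k hk => by have := run1 k (by omega); nlinarith)
      (fun k hk hk1 => by have := run2 k (by omega); nlinarith)
    exact ⟨0, p, cycUnimodalAt_zero_of_peak _ g hfg hp hasc hdesc⟩
  · -- valley: down on run 1, up on run 2
    obtain ⟨p, hp, hdesc, hasc⟩ := exists_valley_of_two_runs (q := q) g hJ
      (fun k hk => by have := run1 k (by omega); nlinarith)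
      (fun k hk hk1 => by have := run2 k (by omega); nlinarith)
    exact cycUnimodal_of_valley _ g hfg hp hdesc hasc

/-- The same for a unit multiplier `u` (step `u.val`). [folklore] -/
theorem convexlyOrdered_chordVec_parabola_unit (P Q : ℝ) (u : (ZMod q)ˣ) :
    ConvexlyOrdered (chordVec (fun z : ZMod q => ![P * (z.val : ℝ), Q * (z.val : ℝ) ^ 2]) (u : ZMod q)) := by
  have h := convexlyOrdered_chordVec_parabola (q := q) P Q (ZMod.val_lt (u : ZMod q))
  have e : (((u : ZMod q).val : ℕ) : ZMod q) = (u : ZMod q) := ZMod.natCast_zmod_val _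
  rw [e] at h
  exact h

/-- **The census families with a multiplier, by name.**  For two census parabolas with natural labels and a third read with the
multiplier `u` (a unit; `m = u.val`): `T ≤ (2 + 2 + 2·min(m, q − m))·q² + 6Z`. [folklore] -/
theorem totalVert_parabolas_multiplier_le (P₁ Q₁ P₂ Q₂ P₃ Q₃ : ℝ) (u : (ZMod q)ˣ) :
    totalVert (fun z : ZMod q => ![P₁ * (z.val : ℝ), Q₁ * (z.val : ℝ) ^ 2]) (fun z : ZMod q => ![P₂ * (z.val : ℝ), Q₂ * (z.val : ℝ) ^ 2])
        (fun k : ZMod q => ![P₃ * (((u : ZMod q) * k).val : ℝ), Q₃ * (((u : ZMod q) * k).val : ℝ) ^ 2]) ≤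
      (2 + 2 + 2 * min (u : ZMod q).val (q - (u : ZMod q).val)) * q ^ 2 +
        6 * zeroCount (fun z : ZMod q => ![P₁ * (z.val : ℝ), Q₁ * (z.val : ℝ) ^ 2])
          (fun z : ZMod q => ![P₂ * (z.val : ℝ), Q₂ * (z.val : ℝ) ^ 2])
          (fun k : ZMod q => ![P₃ * (((u : ZMod q) * k).val : ℝ), Q₃ * (((u : ZMod q) * k).val : ℝ) ^ 2]) := by
  have ha := (convexlyOrdered_edgeVec_parabola (q := q) P₁ Q₁).fewCrossings
  have hb := (convexlyOrdered_edgeVec_parabola (q := q) P₂ Q₂).fewCrossings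
  have hc := fewCrossings_edgeVec_comp_unitMul (fun z : ZMod q => ![P₃ * (z.val : ℝ), Q₃ * (z.val : ℝ) ^ 2]) u
    (convexlyOrdered_chordVec_parabola_unit P₃ Q₃ u)
  exact totalVert_le_of_fewCrossings _ _ _ ha hb hc

end MultiplierParabola

end TotalsLaw

end Summit.ValiantsHypothesis.ValiantsHypothesis.Theorems.NewtonUnitEquationsDissociatedUniform
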